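import Summits.QuantumFields.BalabanUV.T4Continuum.Support.BlockAveragePushDirGauge
import Literature.MathematicalPhysics.QuantumFieldTheory.Balaban1983to89.B7BlockAvgLog
import HarnessLib

/-!
# T⁴ programme, node NE3, row S6-Y7 (P3 leaf L7 «SLOP», k-level input (K4), file 1∕2) — TWO-VARIABLE SCHWARZ LEMMA AND
# THE BILINEAR SMALLNESS OF `log(e^{−a}e^{a+z}e^{b}) − log(e^{z}e^{b})` AND `log(e^{R−b}e^{b}) − R` (`BlockAverageLogInteraction`);
# file 2∕2 `BlockAverageGaugeExtract` applies them to the gauge extraction at one bond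

Cell `pub-balaban`, NE3 formalisation swarm (`t4/formal/NE3/LEAVES.md` row S5∕S6, sub-row S6-Y7; unit
`b2b-balaban-t4-ne3-formalise-leaf-10`, gen 2).  SHAPE `Statements/S6-Y7-SHAPE-v1.md` §2′ (K4): before the one-step quadratic
remainder of `BlockAverageQuadRemainder` may be charged to a direction `Y = gaugeDir W Λ + R` carrying a (possibly large,
non-decaying) gauge component, the gauge component must be EXTRACTED as an exact gauge transformation:
`W(b)·e^{Y(b)} = u(x)·(W(b)·e^{R′(b)})·u(x+e_μ)⁻¹`, `u = e^{Λ}`, and the new non-gauge field `R′` differs from `R` only by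
INTERACTION terms — products of `Λ` at the two ends of the bond, or of `Λ` with `R` — never by `‖Λ(x)‖²` alone (a
single isolated gauge charge is extracted EXACTLY: `R = 0`, `Λ(x+e_μ) = 0 ⇒ R′ = 0`).  THIS FILE: §1 a two-variable Schwarz
lemma — a separately holomorphic `H(σ,τ)` on a bidisc, bounded by `M`, vanishing on both axes, obeys
`‖H(σ,τ)‖ ≤ M·(|σ|∕ρ)·(|τ|∕ρ)` (Mathlib `Complex.norm_dslope_le_div_of_mapsTo_ball`, twice); §2 the two elementary
logarithms `log(e^{−a}e^{a+z}e^{b}) − log(e^{z}e^{b})` (vanishes at `a = 0` and at `z = 0`) and `log(e^{R−b}e^{b}) − R`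
(vanishes at `b = 0` and at `R = 0`), holomorphic in the scaling parameters (`NormedSpace.exp_analytic`, tree
`MatrixLog.analyticAt_mlog`, `B7BlockAvgLog.mlog_exp`), hence bilinearly small; §3 the extraction at one bond:
`gaugeExtract W Λ R x μ := log(e^{−Ad_{W(b)⁻¹}Λ(x)} · e^{gaugeDir W Λ (b) + R(b)} · e^{Λ(x+e_μ)})`, the exact identity
(`vary W (gaugeDir W Λ + R) 1 (b) = gaugeAct (e^{Λ}) (vary W (gaugeExtract W Λ R) 1) (b)` inside the ball) and the bound.

HONEST FRAMING: finite-`T⁴` kinematics at ONE bond (rung (B)+1 — NOT infinite volume, NOT a mass gap, NOT Clay); local matrix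
analysis; nothing of NE3 is claimed (NE3-E stays CONDITIONAL on the co-owners' ⟨named structures⟩; the k-level L7(a) stays OPEN ∕
road P3's typed binder — (K5)–(K6) are not here); no `BetaPertH`, no (B), no G-an2-4; no printed sentence is a hypothesis
([cite:] tags are context).  PLACEMENT (human rule 2026-08-19): our work, under `Summits/QuantumFields/BalabanUV/`.
-/

set_option autoImplicit false

open scoped BigOperators Matrix.Norms.L2Operator Topology
open NormedSpace Finset Filter Metric Set

namespace Summit.QuantumFields.BalabanUV.T4Continuum.BlockAverageLogInteraction

open Literature.MathematicalPhysics.QuantumFieldTheory.Balaban1983to89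
open B7Prop1Explicit B7Prop2Explicit MatrixLog UnitaryModel
open T4AveragingDeficitWall hiding Site Plane Plaq Bond
open BlockAveragePushDirGauge (gaugeDir)

noncomputable section

variable {d : ℕ} {n : Type*} [Fintype n] [DecidableEq n]

/-! ## §1 A two-variable Schwarz lemma -/

section Schwarz

variable {F : Type*} [NormedAddCommGroup F] [NormedSpace ℂ F]

/-- ONE VARIABLE: `f` holomorphic on `|t| < ρ`, `‖f‖ ≤ M` there, `f(0) = 0` ⟹ `‖f(t)‖ ≤ M·|t|∕ρ` (Schwarz lemma,
Mathlib `Complex.norm_dslope_le_div_of_mapsTo_ball`). [folklore] -/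
theorem norm_le_of_vanish {f : ℂ → F} {ρ M : ℝ} (hd : DifferentiableOn ℂ f (ball 0 ρ))
    (hM : ∀ t ∈ ball (0 : ℂ) ρ, ‖f t‖ ≤ M) (h0 : f 0 = 0) {t : ℂ} (ht : t ∈ ball (0 : ℂ) ρ) :
    ‖f t‖ ≤ M * (‖t‖ / ρ) := by
  have hmaps : MapsTo f (ball (0 : ℂ) ρ) (closedBall (f 0) M) := fun s hs => by
    rw [mem_closedBall, dist_eq_norm, h0, sub_zero]; exact hM s hs
  have h := Complex.norm_dslope_le_div_of_mapsTo_ball hd hmaps ht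
  have hρ : 0 < ρ := lt_of_le_of_lt (norm_nonneg t) (mem_ball_zero_iff.mp ht)
  have hft : f t = t • dslope f 0 t := by
    have := sub_smul_dslope f 0 t
    rw [sub_zero, h0, sub_zero] at this
    exact this.symm
  rw [hft, norm_smul]
  calc ‖t‖ * ‖dslope f 0 t‖ ≤ ‖t‖ * (M / ρ) := mul_le_mul_of_nonneg_left h (norm_nonneg t)
    _ = M * (‖t‖ / ρ) := by ring

/-- **TWO VARIABLES**: `H` separately holomorphic on the bidisc `|σ|, |τ| < ρ`, `‖H‖ ≤ M` there, `H(0,τ) = 0 = H(σ,0)` ⟹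
`‖H(σ,τ)‖ ≤ M·(|σ|∕ρ)·(|τ|∕ρ)` (Schwarz in `σ` at fixed `τ`, then in `τ` with the improved bound). [folklore] -/
theorem norm_le_of_vanish₂ {H : ℂ → ℂ → F} {ρ M : ℝ}
    (hσ : ∀ τ ∈ ball (0 : ℂ) ρ, DifferentiableOn ℂ (fun σ => H σ τ) (ball 0 ρ))
    (hτ : ∀ σ ∈ ball (0 : ℂ) ρ, DifferentiableOn ℂ (fun τ => H σ τ) (ball 0 ρ))
    (hM : ∀ σ ∈ ball (0 : ℂ) ρ, ∀ τ ∈ ball (0 : ℂ) ρ, ‖H σ τ‖ ≤ M)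
    (h0σ : ∀ τ ∈ ball (0 : ℂ) ρ, H 0 τ = 0) (h0τ : ∀ σ ∈ ball (0 : ℂ) ρ, H σ 0 = 0) {σ τ : ℂ}
    (hs : σ ∈ ball (0 : ℂ) ρ) (ht : τ ∈ ball (0 : ℂ) ρ) :
    ‖H σ τ‖ ≤ M * (‖σ‖ / ρ) * (‖τ‖ / ρ) := by
  -- Schwarz in σ: for every τ′ in the disc, ‖H σ τ′‖ ≤ M‖σ‖/ρ
  have h1 : ∀ τ' ∈ ball (0 : ℂ) ρ, ‖H σ τ'‖ ≤ M * (‖σ‖ / ρ) := fun τ' hτ' =>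
    norm_le_of_vanish (hσ τ' hτ') (fun s hs' => hM s hs' τ' hτ') (h0σ τ' hτ') hs
  -- Schwarz in τ with the bound M‖σ‖/ρ
  exact norm_le_of_vanish (hτ σ hs) h1 (h0τ σ hs) ht

end Schwarz

/-! ## §2 The two elementary logarithms -/

section Logs

variable [Nonempty n]

/-- `‖e^{Y} − 1‖ ≤ e^{r} − 1 ≤ 2r` and `‖e^{Y}‖ ≤ 1 + 2r` for `‖Y‖ ≤ r ≤ 1`. [folklore] -/
theorem norm_exp_sub_one_le_two_mul {Y : Matrix n n ℂ} {r : ℝ} (h : ‖Y‖ ≤ r) (hr : r ≤ 1) :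
    ‖exp Y - 1‖ ≤ 2 * r ∧ ‖exp Y‖ ≤ 1 + 2 * r := by
  have hr0 : 0 ≤ r := (norm_nonneg Y).trans h
  have h1 : ‖exp Y - 1‖ ≤ Real.exp r - 1 := (norm_exp_sub_one_le_of_norm_le h).1
  have h2 : Real.exp r - 1 ≤ 2 * r := by
    have := Real.abs_exp_sub_one_sub_id_le (x := r) (by rwa [abs_of_nonneg hr0])
    have h3 := (abs_le.mp this).2
    nlinarith
  refine ⟨h1.trans h2, ?_⟩
  calc ‖exp Y‖ = ‖(exp Y - 1) + 1‖ := by rw [sub_add_cancel]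
    _ ≤ ‖exp Y - 1‖ + ‖(1 : Matrix n n ℂ)‖ := norm_add_le _ _
    _ ≤ 2 * r + 1 := by rw [norm_one]; linarith
    _ = 1 + 2 * r := by ring

omit [Nonempty n] in
/-- A product of three matrices within `δᵢ` of `1` (with norms `≤ 1 + δᵢ`) is within `(1+δ₁)(1+δ₂)(1+δ₃) − 1` of `1`. [folklore] -/
theorem norm_mul3_sub_one_le {A B C : Matrix n n ℂ} {δ₁ δ₂ δ₃ : ℝ} (hA : ‖A - 1‖ ≤ δ₁) (hB : ‖B - 1‖ ≤ δ₂) (hC : ‖C - 1‖ ≤ δ₃) :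
    ‖A * B * C - 1‖ ≤ (1 + δ₁) * (1 + δ₂) * (1 + δ₃) - 1 := by
  have h1 := B7Prop6Bound.mul_sub_one_norm_le (A * B) C
  have h2 := B7Prop6Bound.mul_sub_one_norm_le A B
  have hδ₁ : 0 ≤ δ₁ := (norm_nonneg _).trans hA
  have hδ₂ : 0 ≤ δ₂ := (norm_nonneg _).trans hB
  have hδ₃ : 0 ≤ δ₃ := (norm_nonneg _).trans hC
  have h3 : ‖A * B - 1‖ ≤ (1 + δ₁) * (1 + δ₂) - 1 := h2.trans (by nlinarith [norm_nonneg (A - 1), norm_nonneg (B - 1)])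
  calc ‖A * B * C - 1‖ ≤ (1 + ‖A * B - 1‖) * (1 + ‖C - 1‖) - 1 := h1
    _ ≤ (1 + δ₁) * (1 + δ₂) * (1 + δ₃) - 1 := by
        have : 0 ≤ 1 + ‖C - 1‖ := by positivity
        nlinarith [norm_nonneg (A * B - 1), norm_nonneg (C - 1)]

/-- THE FIRST LOGARITHM, as a function of two complex scalings: `F(σ,τ) = log(e^{−σa}e^{σa+τz}e^{b}) − log(e^{τz}e^{b})`.
[folklore] -/
def logF (a z b : Matrix n n ℂ) (σ τ : ℂ) : Matrix n n ℂ :=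
  mlog (exp (-(σ • a)) * exp (σ • a + τ • z) * exp b) - mlog (exp (τ • z) * exp b)

/-- THE SECOND LOGARITHM: `K(σ,τ) = log(e^{τR − σb}e^{σb}) − τR`. [folklore] -/
def logK (b R : Matrix n n ℂ) (σ τ : ℂ) : Matrix n n ℂ :=
  mlog (exp (τ • R - σ • b) * exp (σ • b)) - τ • R

omit [Nonempty n] in
/-- `F(0,τ) = 0`. [folklore] -/
theorem logF_zero_left (a z b : Matrix n n ℂ) (τ : ℂ) : logF a z b 0 τ = 0 := by
  simp [logF]

omit [Nonempty n] in
/-- `F(σ,0) = 0` (`e^{−σa}e^{σa} = 1`). [folklore] -/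
theorem logF_zero_right (a z b : Matrix n n ℂ) (σ : ℂ) : logF a z b σ 0 = 0 := by
  have h : exp (-(σ • a)) * exp (σ • a) = 1 := by
    have := (expUnit (σ • a)).inv_val
    simpa [expUnit] using this
  simp [logF, h]

omit [Nonempty n] in
/-- `K(0,τ) = 0` (`log e^{τR} = τR` for `‖τR‖ < log 2`, tree `B7BlockAvgLog.mlog_exp`). [folklore] -/
theorem logK_zero_left {b R : Matrix n n ℂ} {τ : ℂ} (h : ‖τ • R‖ < Real.log 2) : logK b R 0 τ = 0 := by
  simp only [logK, zero_smul, sub_zero, exp_zero, mul_one]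
  rw [B7BlockAvgLog.mlog_exp h, sub_self]

omit [Nonempty n] in
/-- `K(σ,0) = 0` (`e^{−σb}e^{σb} = 1`). [folklore] -/
theorem logK_zero_right (b R : Matrix n n ℂ) (σ : ℂ) : logK b R σ 0 = 0 := by
  have h : exp (-(σ • b)) * exp (σ • b) = 1 := by
    have := (expUnit (σ • b)).inv_val
    simpa [expUnit] using this
  simp [logK, h]

/-- DOMAIN CONTROL for the first logarithm: with `|σ|‖a‖, |τ|‖z‖, ‖b‖ ≤ 1∕32` both products are within `1∕2` of `1`, and
`‖F(σ,τ)‖ ≤ 2`. [folklore] -/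
theorem logF_control {a z b : Matrix n n ℂ} {σ τ : ℂ} (ha : ‖σ‖ * ‖a‖ ≤ 1 / 32) (hz : ‖τ‖ * ‖z‖ ≤ 1 / 32) (hb : ‖b‖ ≤ 1 / 32) :
    ‖exp (-(σ • a)) * exp (σ • a + τ • z) * exp b - 1‖ ≤ 1 / 2 ∧ ‖exp (τ • z) * exp b - 1‖ ≤ 1 / 2 ∧
      ‖logF a z b σ τ‖ ≤ 2 := by
  have h1 : ‖-(σ • a)‖ ≤ 1 / 32 := by rw [norm_neg, norm_smul]; exact ha
  have h2 : ‖σ • a + τ • z‖ ≤ 1 / 16 := by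
    refine (norm_add_le _ _).trans ?_; rw [norm_smul, norm_smul]; linarith
  have h3 : ‖τ • z‖ ≤ 1 / 32 := by rw [norm_smul]; exact hz
  obtain ⟨e1, -⟩ := norm_exp_sub_one_le_two_mul h1 (by norm_num)
  obtain ⟨e2, -⟩ := norm_exp_sub_one_le_two_mul h2 (by norm_num)
  obtain ⟨e3, -⟩ := norm_exp_sub_one_le_two_mul h3 (by norm_num)
  obtain ⟨e4, -⟩ := norm_exp_sub_one_le_two_mul hb (by norm_num)
  have hP : ‖exp (-(σ • a)) * exp (σ • a + τ • z) * exp b - 1‖ ≤ 1 / 2 :=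
    (norm_mul3_sub_one_le e1 e2 e4).trans (by norm_num)
  have hQ : ‖exp (τ • z) * exp b - 1‖ ≤ 1 / 2 := by
    refine (B7Prop6Bound.mul_sub_one_norm_le _ _).trans ?_
    nlinarith [norm_nonneg (exp (τ • z) - 1), norm_nonneg (exp b - 1)]
  refine ⟨hP, hQ, ?_⟩
  calc ‖logF a z b σ τ‖ ≤ ‖mlog (exp (-(σ • a)) * exp (σ • a + τ • z) * exp b)‖ + ‖mlog (exp (τ • z) * exp b)‖ :=
        norm_sub_le _ _
    _ ≤ 2 * (1 / 2) + 2 * (1 / 2) := add_le_add ((norm_mlog_le_two_mul hP).trans (by linarith))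
        ((norm_mlog_le_two_mul hQ).trans (by linarith))
    _ = 2 := by norm_num

/-- DOMAIN CONTROL for the second logarithm: with `|σ|‖b‖, |τ|‖R‖ ≤ 1∕32`, the product is within `1∕2` of `1` and
`‖K(σ,τ)‖ ≤ 2`. [folklore] -/
theorem logK_control {b R : Matrix n n ℂ} {σ τ : ℂ} (hb : ‖σ‖ * ‖b‖ ≤ 1 / 32) (hR : ‖τ‖ * ‖R‖ ≤ 1 / 32) :
    ‖exp (τ • R - σ • b) * exp (σ • b) - 1‖ ≤ 1 / 2 ∧ ‖logK b R σ τ‖ ≤ 2 := by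
  have h1 : ‖τ • R - σ • b‖ ≤ 1 / 16 := by
    refine (norm_sub_le _ _).trans ?_; rw [norm_smul, norm_smul]; linarith
  have h2 : ‖σ • b‖ ≤ 1 / 32 := by rw [norm_smul]; exact hb
  obtain ⟨e1, -⟩ := norm_exp_sub_one_le_two_mul h1 (by norm_num)
  obtain ⟨e2, -⟩ := norm_exp_sub_one_le_two_mul h2 (by norm_num)
  have hP : ‖exp (τ • R - σ • b) * exp (σ • b) - 1‖ ≤ 1 / 2 := by
    refine (B7Prop6Bound.mul_sub_one_norm_le _ _).trans ?_
    nlinarith [norm_nonneg (exp (τ • R - σ • b) - 1), norm_nonneg (exp (σ • b) - 1)]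
  refine ⟨hP, ?_⟩
  have hτR : ‖τ • R‖ ≤ 1 / 32 := by rw [norm_smul]; exact hR
  calc ‖logK b R σ τ‖ ≤ ‖mlog (exp (τ • R - σ • b) * exp (σ • b))‖ + ‖τ • R‖ := norm_sub_le _ _
    _ ≤ 2 * (1 / 2) + 1 / 32 := add_le_add ((norm_mlog_le_two_mul hP).trans (by linarith)) hτR
    _ ≤ 2 := by norm_num

/-- Holomorphy of the first logarithm in `σ` (at fixed `τ`) and in `τ` (at fixed `σ`), inside the domain. [folklore] -/
theorem analyticAt_logF {a z b : Matrix n n ℂ} {σ τ : ℂ} (ha : ‖σ‖ * ‖a‖ ≤ 1 / 32) (hz : ‖τ‖ * ‖z‖ ≤ 1 / 32)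
    (hb : ‖b‖ ≤ 1 / 32) :
    AnalyticAt ℂ (fun s => logF a z b s τ) σ ∧ AnalyticAt ℂ (fun t => logF a z b σ t) τ := by
  obtain ⟨hP, hQ, -⟩ := logF_control ha hz hb
  have hP1 : ‖exp (-(σ • a)) * exp (σ • a + τ • z) * exp b - 1‖ < 1 := hP.trans_lt (by norm_num)
  have hQ1 : ‖exp (τ • z) * exp b - 1‖ < 1 := hQ.trans_lt (by norm_num)
  constructor
  · -- in σ
    have h1 : AnalyticAt ℂ (fun s : ℂ => exp (-(s • a)) * exp (s • a + τ • z) * exp b) σ :=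
      ((((exp_analytic _).fun_comp_of_eq (analyticAt_id.fun_smul analyticAt_const).fun_neg rfl).fun_mul
        ((exp_analytic _).fun_comp_of_eq ((analyticAt_id.fun_smul analyticAt_const).fun_add analyticAt_const) rfl)).fun_mul
        analyticAt_const)
    unfold logF
    exact ((analyticAt_mlog hP1).fun_comp_of_eq h1 rfl).fun_sub analyticAt_const
  · -- in τ
    have h1 : AnalyticAt ℂ (fun t : ℂ => exp (-(σ • a)) * exp (σ • a + t • z) * exp b) τ :=
      ((analyticAt_const.fun_mul
        ((exp_analytic _).fun_comp_of_eq (analyticAt_const.fun_add (analyticAt_id.fun_smul analyticAt_const)) rfl)).fun_mul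
        analyticAt_const)
    have h2 : AnalyticAt ℂ (fun t : ℂ => exp (t • z) * exp b) τ :=
      ((exp_analytic _).fun_comp_of_eq (analyticAt_id.fun_smul analyticAt_const) rfl).fun_mul analyticAt_const
    unfold logF
    exact ((analyticAt_mlog hP1).fun_comp_of_eq h1 rfl).fun_sub ((analyticAt_mlog hQ1).fun_comp_of_eq h2 rfl)

/-- Holomorphy of the second logarithm in `σ` and in `τ`, inside the domain. [folklore] -/
theorem analyticAt_logK {b R : Matrix n n ℂ} {σ τ : ℂ} (hb : ‖σ‖ * ‖b‖ ≤ 1 / 32) (hR : ‖τ‖ * ‖R‖ ≤ 1 / 32) :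
    AnalyticAt ℂ (fun s => logK b R s τ) σ ∧ AnalyticAt ℂ (fun t => logK b R σ t) τ := by
  obtain ⟨hP, -⟩ := logK_control hb hR
  have hP1 : ‖exp (τ • R - σ • b) * exp (σ • b) - 1‖ < 1 := hP.trans_lt (by norm_num)
  constructor
  · have h1 : AnalyticAt ℂ (fun s : ℂ => exp (τ • R - s • b) * exp (s • b)) σ :=
      ((exp_analytic _).fun_comp_of_eq (analyticAt_const.fun_sub (analyticAt_id.fun_smul analyticAt_const)) rfl).fun_mul
        ((exp_analytic _).fun_comp_of_eq (analyticAt_id.fun_smul analyticAt_const) rfl)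
    unfold logK
    exact ((analyticAt_mlog hP1).fun_comp_of_eq h1 rfl).fun_sub analyticAt_const
  · have h1 : AnalyticAt ℂ (fun t : ℂ => exp (t • R - σ • b) * exp (σ • b)) τ :=
      ((exp_analytic _).fun_comp_of_eq ((analyticAt_id.fun_smul analyticAt_const).fun_sub analyticAt_const) rfl).fun_mul
        analyticAt_const
    unfold logK
    exact ((analyticAt_mlog hP1).fun_comp_of_eq h1 rfl).fun_sub (analyticAt_id.fun_smul analyticAt_const)

/-- **THE FIRST LOGARITHM IS BILINEARLY SMALL**: for `‖a‖, ‖z‖ < 1∕32` and `‖b‖ ≤ 1∕32`,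
`‖log(e^{−a}e^{a+z}e^{b}) − log(e^{z}e^{b})‖ ≤ 2·(‖a‖∕(1∕32))·(‖z‖∕(1∕32)) = 2048·‖a‖·‖z‖`.
[folklore] -/
theorem norm_logF_one_one_le {a z b : Matrix n n ℂ} (ha : ‖a‖ < 1 / 32) (hz : ‖z‖ < 1 / 32) (hb : ‖b‖ ≤ 1 / 32) :
    ‖logF a z b 1 1‖ ≤ 2 * (‖a‖ / (1 / 32)) * (‖z‖ / (1 / 32)) := by
  -- scale: H(σ,τ) := logF a z b (σ·?)… we use the bidisc of radius ρ = 1/32 in the variables (σ‖a‖-normalised) directly: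
  -- with H σ τ := logF (a/‖a‖·(1/32))… simpler: apply the lemma to H σ τ := logF a z b (σ / (‖a‖·32))… we avoid division by
  -- taking H σ τ := logF a z b σ' τ' with σ' = σ·(1/32)/‖a‖ only when a ≠ 0; handle a = 0 and z = 0 first.
  by_cases ha0 : a = 0
  · subst ha0; simp [logF]
  by_cases hz0 : z = 0
  · subst hz0
    have : logF a (0 : Matrix n n ℂ) b 1 1 = 0 := by
      have h := logF_zero_right a (0 : Matrix n n ℂ) b 1
      simpa [logF] using h
    rw [this, norm_zero]; positivity
  have han : 0 < ‖a‖ := norm_pos_iff.mpr ha0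
  have hzn : 0 < ‖z‖ := norm_pos_iff.mpr hz0
  -- normalised directions
  set a₀ : Matrix n n ℂ := ((1 / 32 : ℝ) / ‖a‖ : ℝ) • a with ha₀
  set z₀ : Matrix n n ℂ := ((1 / 32 : ℝ) / ‖z‖ : ℝ) • z with hz₀
  have ha₀n : ‖a₀‖ = 1 / 32 := by
    rw [ha₀, norm_smul, Real.norm_eq_abs, abs_of_pos (by positivity)]; field_simp
  have hz₀n : ‖z₀‖ = 1 / 32 := by
    rw [hz₀, norm_smul, Real.norm_eq_abs, abs_of_pos (by positivity)]; field_simp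
  -- the scalings that recover a and z
  set σ₁ : ℂ := ((‖a‖ / (1 / 32) : ℝ) : ℂ) with hσ₁
  set τ₁ : ℂ := ((‖z‖ / (1 / 32) : ℝ) : ℂ) with hτ₁
  have hσ₁a : σ₁ • a₀ = a := by
    rw [hσ₁, ha₀, Complex.coe_smul, smul_smul]; field_simp; exact one_smul _ _
  have hτ₁z : τ₁ • z₀ = z := by
    rw [hτ₁, hz₀, Complex.coe_smul, smul_smul]; field_simp; exact one_smul _ _
  have hσ₁n : ‖σ₁‖ = ‖a‖ / (1 / 32) := by rw [hσ₁, Complex.norm_real, Real.norm_eq_abs, abs_of_pos (by positivity)]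
  have hτ₁n : ‖τ₁‖ = ‖z‖ / (1 / 32) := by rw [hτ₁, Complex.norm_real, Real.norm_eq_abs, abs_of_pos (by positivity)]
  have hσ₁b : σ₁ ∈ ball (0 : ℂ) 1 := by rw [mem_ball_zero_iff, hσ₁n, div_lt_one (by norm_num)]; exact ha
  have hτ₁b : τ₁ ∈ ball (0 : ℂ) 1 := by rw [mem_ball_zero_iff, hτ₁n, div_lt_one (by norm_num)]; exact hz
  -- on the unit bidisc the hypotheses of the control lemma hold for (a₀, z₀)
  have hdom : ∀ σ ∈ ball (0 : ℂ) 1, ∀ τ ∈ ball (0 : ℂ) 1, ‖σ‖ * ‖a₀‖ ≤ 1 / 32 ∧ ‖τ‖ * ‖z₀‖ ≤ 1 / 32 := by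
    intro σ hσ τ hτ
    rw [mem_ball_zero_iff] at hσ hτ
    rw [ha₀n, hz₀n]
    constructor <;> nlinarith [norm_nonneg σ, norm_nonneg τ]
  have key := norm_le_of_vanish₂ (H := logF a₀ z₀ b) (ρ := 1) (M := 2)
    (fun τ hτ σ hσ => ((analyticAt_logF (hdom σ hσ τ hτ).1 (hdom σ hσ τ hτ).2 hb).1).differentiableAt.differentiableWithinAt)
    (fun σ hσ τ hτ => ((analyticAt_logF (hdom σ hσ τ hτ).1 (hdom σ hσ τ hτ).2 hb).2).differentiableAt.differentiableWithinAt)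
    (fun σ hσ τ hτ => (logF_control (hdom σ hσ τ hτ).1 (hdom σ hσ τ hτ).2 hb).2.2)
    (fun τ _ => logF_zero_left a₀ z₀ b τ) (fun σ _ => logF_zero_right a₀ z₀ b σ) hσ₁b hτ₁b
  have hval : logF a₀ z₀ b σ₁ τ₁ = logF a z b 1 1 := by
    simp only [logF, one_smul, hσ₁a, hτ₁z]
  rw [hval, hσ₁n, hτ₁n, div_one, div_one] at key
  exact key

/-- **THE SECOND LOGARITHM IS BILINEARLY SMALL**: for `‖b‖, ‖R‖ < 1∕32`,
`‖log(e^{R−b}e^{b}) − R‖ ≤ 2·(‖b‖∕(1∕32))·(‖R‖∕(1∕32))`. [folklore] -/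
theorem norm_logK_one_one_le {b R : Matrix n n ℂ} (hb : ‖b‖ < 1 / 32) (hR : ‖R‖ < 1 / 32) :
    ‖logK b R 1 1‖ ≤ 2 * (‖b‖ / (1 / 32)) * (‖R‖ / (1 / 32)) := by
  by_cases hb0 : b = 0
  · subst hb0
    have : logK (0 : Matrix n n ℂ) R 1 1 = 0 := by
      have h := logK_zero_left (b := (0 : Matrix n n ℂ)) (R := R) (τ := 1)
        (by rw [one_smul]; exact hR.trans (by have := Real.log_two_gt_d9; linarith))
      simpa [logK] using h
    rw [this, norm_zero]; positivity
  by_cases hR0 : R = 0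
  · subst hR0
    have : logK b (0 : Matrix n n ℂ) 1 1 = 0 := by
      have h := logK_zero_right b (0 : Matrix n n ℂ) 1
      simpa [logK] using h
    rw [this, norm_zero]; positivity
  have hbn : 0 < ‖b‖ := norm_pos_iff.mpr hb0
  have hRn : 0 < ‖R‖ := norm_pos_iff.mpr hR0
  set b₀ : Matrix n n ℂ := ((1 / 32 : ℝ) / ‖b‖ : ℝ) • b with hb₀
  set R₀ : Matrix n n ℂ := ((1 / 32 : ℝ) / ‖R‖ : ℝ) • R with hR₀
  have hb₀n : ‖b₀‖ = 1 / 32 := by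
    rw [hb₀, norm_smul, Real.norm_eq_abs, abs_of_pos (by positivity)]; field_simp
  have hR₀n : ‖R₀‖ = 1 / 32 := by
    rw [hR₀, norm_smul, Real.norm_eq_abs, abs_of_pos (by positivity)]; field_simp
  set σ₁ : ℂ := ((‖b‖ / (1 / 32) : ℝ) : ℂ) with hσ₁
  set τ₁ : ℂ := ((‖R‖ / (1 / 32) : ℝ) : ℂ) with hτ₁
  have hσ₁b₀ : σ₁ • b₀ = b := by
    rw [hσ₁, hb₀, Complex.coe_smul, smul_smul]; field_simp; exact one_smul _ _
  have hτ₁R₀ : τ₁ • R₀ = R := by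
    rw [hτ₁, hR₀, Complex.coe_smul, smul_smul]; field_simp; exact one_smul _ _
  have hσ₁n : ‖σ₁‖ = ‖b‖ / (1 / 32) := by rw [hσ₁, Complex.norm_real, Real.norm_eq_abs, abs_of_pos (by positivity)]
  have hτ₁n : ‖τ₁‖ = ‖R‖ / (1 / 32) := by rw [hτ₁, Complex.norm_real, Real.norm_eq_abs, abs_of_pos (by positivity)]
  have hσ₁b : σ₁ ∈ ball (0 : ℂ) 1 := by rw [mem_ball_zero_iff, hσ₁n, div_lt_one (by norm_num)]; exact hb
  have hτ₁b : τ₁ ∈ ball (0 : ℂ) 1 := by rw [mem_ball_zero_iff, hτ₁n, div_lt_one (by norm_num)]; exact hR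
  have hdom : ∀ σ ∈ ball (0 : ℂ) 1, ∀ τ ∈ ball (0 : ℂ) 1, ‖σ‖ * ‖b₀‖ ≤ 1 / 32 ∧ ‖τ‖ * ‖R₀‖ ≤ 1 / 32 := by
    intro σ hσ τ hτ
    rw [mem_ball_zero_iff] at hσ hτ
    rw [hb₀n, hR₀n]
    constructor <;> nlinarith [norm_nonneg σ, norm_nonneg τ]
  have hlog2 : ∀ τ ∈ ball (0 : ℂ) 1, ‖τ • R₀‖ < Real.log 2 := by
    intro τ hτ
    rw [mem_ball_zero_iff] at hτ
    rw [norm_smul, hR₀n]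
    have := Real.log_two_gt_d9
    nlinarith [norm_nonneg τ]
  have key := norm_le_of_vanish₂ (H := logK b₀ R₀) (ρ := 1) (M := 2)
    (fun τ hτ σ hσ => ((analyticAt_logK (hdom σ hσ τ hτ).1 (hdom σ hσ τ hτ).2).1).differentiableAt.differentiableWithinAt)
    (fun σ hσ τ hτ => ((analyticAt_logK (hdom σ hσ τ hτ).1 (hdom σ hσ τ hτ).2).2).differentiableAt.differentiableWithinAt)
    (fun σ hσ τ hτ => (logK_control (hdom σ hσ τ hτ).1 (hdom σ hσ τ hτ).2).2)
    (fun τ hτ => logK_zero_left (hlog2 τ hτ)) (fun σ _ => logK_zero_right b₀ R₀ σ) hσ₁b hτ₁b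
  have hval : logK b₀ R₀ σ₁ τ₁ = logK b R 1 1 := by
    simp only [logK, one_smul, hσ₁b₀, hτ₁R₀]
  rw [hval, hσ₁n, hτ₁n, div_one, div_one] at key
  exact key

end Logs

end

end Summit.QuantumFields.BalabanUV.T4Continuum.BlockAverageLogInteraction
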